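import Literature.Barriers.CriticalPhenomena.SupercriticalSAWSpaceFillingNarrow
import Literature.Barriers.CriticalPhenomena.SupercriticalSAWSpaceFillingRefutation
import Literature.Probability.RandomPlanarGeometry.RestrictionHullsHolds
import Literature.Probability.RandomPlanarGeometry.CritPercSLESimplePathHolds
import HarnessLib

/-!
# Barrier audit (gen 2) of `SupercriticalSAWSpaceFillingSteps`: Theorem 6 of
# Duminil-Copin–Kozma–Yadin for the disk is a statement about ONE box-polygon partition
# function — the effective form, its reach along fugacity schedules, and the enumerative
# necessary condition it imposes on the sub-problem at `x_c`

Barrier catalogue `Literature/Barriers/CriticalPhenomena/` (D-0021). Companion of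
`SupercriticalSAWSpaceFillingSteps.lean`, whose named fact `SupercriticalSAW.DKY2014_thm6_disk`
(Theorem 6 of H. Duminil-Copin, G. Kozma, A. Yadin, *Supercritical self-avoiding walks are
space-filling*, Ann. IHP Probab. Stat. 50 (2014) 315–326, arXiv:1110.3074, for `Ω = 𝔻`) is
PROVED in the tree (`SupercriticalSAW.DKY2014_thm6_disk_holds`, `…TilesTheorem6.lean`), as is
Theorem 1 (`SupercriticalSAW.DKY2014_thm1_holds`) and the whole lower chain eq. (2.1) → Lemma 5 →
Proposition 3 (`Literature.Probability.RandomPlanarGeometry.SAW.DKY2014_prop3_holds`). Outcome of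
the audit of 2026-08-15 (refuter, gen 2): **the Steps facts are CONFIRMED (machine-checked); what
they obstruct is SHARPENED to an effective criterion.**

## What the audit found (page numbers of arXiv:1110.3074v3)

1. **Supercriticality enters Theorem 6 at exactly one point.** §3 opens (p. 6): "choosing `m`
   large enough (or equivalently `Z_m(x)` large enough), the probability to avoid some connected
   union of `k` boxes decays exponentially fast in `k`", and the printed proof of Theorem 6
   (p. 7) uses `x > 1/μ` only in "We now apply Proposition 3 and get some `m = m(x,2)` such that
   `Z_m(x) > 2λ`" (`λ` the lattice-animal constant); Proposition 7 (p. 6) and the Peierls sum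
   hold for every `x > 0` and every `m`. The same is true of the tree's proof: every lemma of
   `…TilesDeep/…/TilesUnion/TilesTheorem6` asks only `0 < x` and `x^{4r+2} Z_m(x) ≥ 1600`
   (`r = 4`). Hence the EFFECTIVE THEOREM 6 (`DKY2014_thm6_disk_effective`, proved here by the
   tree's own argument with the scale `m` left free): for every fugacity `x > 0` and every box
   scale `m` with `x^{18} Z_m(x) ≥ 1600`, the disk walk with parameter `x` leaves a component of
   `𝔻_δ ∖ Γ_δ^ξ` with more than `s` sites with probability `≤ (C/δ²) e^{-c s}` for
   `0 < δ < δ₀`, with EXPLICIT tube radius `ξ = xiP m 4 = 28(m + 8)` lattice steps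
   (`xiP_four`), rate `c = rateConst m x`, prefactor `C = prefConst m x` and mesh threshold
   `δ₀ = meshThreshold m x a b ≤ (9m + 75)⁻²` (`meshThreshold_le`). Consequently Theorem 1, the
   weak space-filling of §1 and the refutation of SLE_{8/3} convergence hold at every such `x`
   (`tendsto_lawAt_hasLargeHole_of_Zbox`, `isSpaceFillingFamily_of_Zbox`,
   `not_sawScalingLimitAt_of_Zbox` — the last one unconditional, the two SLE_{8/3} inputs being
   theorems of the tree: `sle_restriction_eightThirds_holds` [LSW03, Thm 6.1],
   `ae_isSimpleTrace_sleTrace_of_le_four_holds` [RS05, Thm 6.1]).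
2. **The blocked set of fugacities is the up-set `B = {x > 0 : ∃ m, x^{18} Z_m(x) ≥ 1600}`**,
   which contains `(x_c, ∞)` by Proposition 3 (p. 4) and is all that the mechanism sees. Whether
   `x_c ∈ B` is not decided by any theorem — but the sub-problem decides it: since
   `SAWScalingLimit = SAWScalingLimitAt x_c`, the tree's form of the Lawler–Schramm–Werner
   conjecture IMPLIES the enumerative bound `x_c^{18} Z_m(x_c) < 1600` for every `m`
   (`Zbox_lt_of_sawScalingLimit`; likewise a YES to the source's open Problem 10 for the disk,
   `Zbox_lt_of_DKY2014_problem10_disk`). Rigorously only polynomial bounds are available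
   (`Z_m(x_c) = O(m⁴)`: a polygon of `P_m` has at most `(2m+2)²` edges and contains a fixed
   cardinal edge, and `q_N ≤ μ^N` [MS93, (3.2.5)]); the expected behaviour is
   `sup_m Z_m(x_c) < ∞` (each of the four pinnings costs a boundary exponent). So the barrier's
   mechanism is not "supercritical" but a finite-size criterion, checkable at any given `(x, m)`
   by a finite computation, and its failure at `x_c` for all `m` is a NECESSARY CONDITION for the
   conjunct — an exact, if numerically remote, falsifier.
3. **Reach along schedules `x(δ) ↓ x_c` (the "rate question" left open by the audit
   `SupercriticalSAWSpaceFillingNarrow`, scope_caveats).** With `m*(x) := min {m : x^{18} Z_m(x)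
   ≥ 1600}` (finite exactly on `B`), the effective theorem covers the pairs `(x, δ)` with
   `δ < meshThreshold (m*(x)) x a b`, in particular it needs `m*(x(δ)) ≤ (9^{-1}) δ^{-1/2}`; the
   source itself warns that the box scale of Proposition 3 is inexplicit — the maximising span
   `m(n)` of squared walks: "finding the maximal `m` as an explicit function of `n`, even
   asymptotically, seems difficult, probably no easier than the SLE_{8/3} conjecture. But we do
   not need to know its value" (p. 5) — and only the trivial `m(n) ≤ n/2` with the
   Hammersley–Welsh loss `e^{-c√n}` (eq. (2.1), p. 4; `n(x) ≍ c²/log²(xμ)`) is available, so the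
   printed mechanism provably certifies windows `x(δ) - x_c ≫ δ^{a}` only for a small explicit
   `a > 0` (about `1/6` with this file's constants: the prefactor `prefConst m x` grows like
   `max(1,x⁻¹)^{80m}` and the rate decays like `m⁻²`, so the scale must satisfy
   `m*(x(δ))³ δ → 0`), far from the conjectural crossover `δ^{4/3}` recorded in
   `SupercriticalSAWSpaceFillingNarrow`. Formally: along ANY schedule
   `X` with scales `M` satisfying the criterion, the mesh threshold and two explicit growth
   conditions, the laws are space-filling and `¬ SAWScalingLimitAlong X`
   (`isSpaceFillingLaws_of_Zbox_schedule`, `not_sawScalingLimitAlong_of_Zbox_schedule`).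
4. Page-level confirmation of the Steps file: Theorem 6 and "Theorem 1 given Theorem 6. Here our
   domain is `𝔻` … Taking `λ = C₁ log(1/δ)` for `C₁` sufficiently large gives the result" are
   verbatim on p. 6; the vendored disk instance adds `a ≠ b` and `δ < δ₀(x,a,b)` (documented in
   Steps; necessary, cf. `…FilamentsCuspCharitable`). A secondary source overstates the theorem
   as convergence "to a random continuous curve filling the whole domain `Ω`" for general `Ω`
   [DC13, §1.2 (Phase transition for SAWs)], which the source's own "bridge of width `δ`" remark
   (p. 3) excludes and which Theorem 1 (holes, no convergence) does not assert.

## Formal content (all proved; one new closed `Prop`, `SupercriticalSAWSpaceFillingStepsNarrow`)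

Closed forms at margin `r = 4`: `hw_four`, `side_four`, `rhoP_four`, `RdP_four`, `KP_four`,
`xiP_four` (`ξ = 28m + 224`), `C3P_four`. Constants `rateConst`, `prefConst`, `meshThreshold`
(`rateConst_pos`, `meshThreshold_pos`, `meshThreshold_le`). `DKY2014_thm6_disk_effective`;
`DKY2014_thm6_disk_of_effective` (the Steps fact re-derived: Proposition 3 is the only
supercritical input); `tendsto_lawAt_hasLargeHole_of_Zbox` (Theorem 1 at `(x, m)`);
`isSpaceFillingFamily_of_Zbox`; `not_sawScalingLimitAt_of_Zbox`; `Zbox_lt_of_sawScalingLimit`,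
`Zbox_lt_of_DKY2014_problem10_disk`; `isSpaceFillingLaws_of_Zbox_schedule`,
`not_sawScalingLimitAlong_of_Zbox_schedule`; the narrowed barrier
`SupercriticalSAWSpaceFillingStepsNarrow` with `SupercriticalSAWSpaceFillingStepsNarrow_holds`.

## References

* H. Duminil-Copin, G. Kozma, A. Yadin, Ann. Inst. Henri Poincaré Probab. Stat. 50 (2014)
  315–326, arXiv:1110.3074: p. 4 (eq. (2.1), Proposition 3, Lemma 5), p. 5 (proof of
  Proposition 3: `Z_m(x) ≥ (x^{n+1}μⁿe^{-c√n}/n)⁴`, the maximising span is inexplicit), p. 6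
  (§3 first paragraph; Theorem 6; Theorem 1 given Theorem 6; Proposition 7), p. 7 (proof of
  Theorem 6: `Z_m(x) > 2λ`), p. 8 (Problems 9–10, Conjecture 11). [DuminilCopinKozmaYadin2014]
* H. Duminil-Copin, *Parafermionic observables and their applications to planar statistical
  physics models*, Ensaios Matemáticos 25 (2013), §1.2 (Phase transition for SAWs: "When
  `x > x_c`, `γ_δ` converges to a random continuous curve filling the whole domain `Ω`").
  [DuminilCopin2013Parafermion]
* N. Madras, G. Slade, *The Self-Avoiding Walk*, Birkhäuser (1993), §3.2, eq. (3.2.5) p. 65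
  (`q_N ≤ (d-1) μ_{Polygon}^N`, `μ_{Polygon} = μ`). [MadrasSlade1993]
* G. F. Lawler, O. Schramm, W. Werner, J. Amer. Math. Soc. 16 (2003), Thm. 6.1.
  [LawlerSchrammWerner2003Restriction]
* S. Rohde, O. Schramm, Ann. of Math. 161 (2005), Thm. 6.1. [RohdeSchramm2005]
-/

noncomputable section

open MeasureTheory Filter Topology Metric Literature.Probability.LatticeModels
  Literature.Probability.Percolation Literature.Probability.RandomPlanarGeometry
  Literature.Probability.RandomPlanarGeometry.SAW
open scoped ENNReal NNReal

namespace Literature.Barriers.CriticalPhenomena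

namespace SupercriticalSAW

/-! ### The tile parameters at margin `r = 4` in closed form -/

/-- `h = m + 5`. [folklore] -/
theorem hw_four (m : ℕ) : OddTile.hw m 4 = m + 5 := by
  unfold OddTile.hw; omega

/-- Tile side `L = 2m + 11`. [folklore] -/
theorem side_four (m : ℕ) : OddTile.side m 4 = 2 * m + 11 := by
  unfold OddTile.side OddTile.hw; omega

/-- `ρ = 8m + 63`. [folklore] -/
theorem rhoP_four (m : ℕ) : rhoP m 4 = 8 * m + 63 := by
  unfold rhoP OddTile.side OddTile.hw; omega

/-- `R_d = 8m + 69`. [folklore] -/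
theorem RdP_four (m : ℕ) : RdP m 4 = 8 * m + 69 := by
  unfold RdP; rw [rhoP_four]

/-- `K = 9m + 75`. [folklore] -/
theorem KP_four (m : ℕ) : KP m 4 = 9 * m + 75 := by
  unfold KP; rw [RdP_four, hw_four]; omega

/-- **The tube radius of the effective Theorem 6 is `ξ = 28m + 224` lattice steps** (the print
has `6m`; the tree's tiles have side `2m + 11` and the surgery needs a collar).
[cite: DuminilCopinKozmaYadin2014, Theorem 6] -/
theorem xiP_four (m : ℕ) : xiP m 4 = 28 * m + 224 := by
  unfold xiP; rw [rhoP_four, KP_four, hw_four]; omega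

/-- `C₃ = (20m + 161)²` (sites of a tile with its collar; the print's `(2m+1)²`).
[cite: DuminilCopinKozmaYadin2014, §3 (proof of Theorem 6: s/(2m+1)² boxes)] -/
theorem C3P_four (m : ℕ) : C3P m 4 = (20 * m + 161) ^ 2 := by
  unfold C3P; rw [KP_four, hw_four]; congr 1; omega

/-! ### The explicit constants of the effective Theorem 6 -/

/-- The exponential rate `c(m, x) = min (log 64 / C₃, log(x^{18} Z_m(x)) / (400 L²))`.
[cite: DuminilCopinKozmaYadin2014, Theorem 6 (c(x))] -/
def rateConst (m : ℕ) (x : ℝ) : ℝ :=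
  min (Real.log 64 / C3P m 4) (Real.log (x ^ 18 * Zbox m x) / (16 * (OddTile.side m 4 : ℝ) ^ 2) / 25)

/-- The prefactor `C(m, x) = A_main + max(16000/Z_m(x), 0)`.
[cite: DuminilCopinKozmaYadin2014, Theorem 6 (C(x,Ω))] -/
def prefConst (m : ℕ) (x : ℝ) : ℝ :=
  Amain m 4 x + max (16000 / Zbox m x) 0

/-- The mesh threshold `δ₀(m, x, a, b) = min(1/10, 1/K², |a-b|/26, 1/(8L(R_d+2)),
log(x^{18}Z_m(x))/(16L²(43 log max(1,x⁻¹) + 2)))`, `K = 9m+75`, `L = 2m+11`, `R_d = 8m+69`.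
[cite: DuminilCopinKozmaYadin2014, Theorem 6] -/
def meshThreshold (m : ℕ) (x : ℝ) (a b : ℂ) : ℝ :=
  min (min (1 / 10) (1 / (KP m 4 : ℝ) ^ 2)) (min (‖a - b‖ / 26)
    (min (1 / (8 * (OddTile.side m 4 : ℝ) * ((RdP m 4 : ℝ) + 2)))
      (Real.log (x ^ 18 * Zbox m x) / (16 * (OddTile.side m 4 : ℝ) ^ 2 * (43 * Real.log (max 1 x⁻¹) + 2)))))

/-- The rate is positive once `x^{18} Z_m(x) ≥ 1600`. [folklore] -/
theorem rateConst_pos {x : ℝ} {m : ℕ} (hm : 1600 ≤ x ^ 18 * Zbox m x) : 0 < rateConst m x := by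
  have hC3 : (0 : ℝ) < C3P m 4 := Nat.cast_pos.2 (by unfold C3P; positivity)
  have hlogY : 0 < Real.log (x ^ 18 * Zbox m x) := Real.log_pos (by linarith)
  have hL1 : (1 : ℝ) ≤ OddTile.side m 4 := by exact_mod_cast OddTile.side_pos (m := m) (r := 4)
  unfold rateConst
  exact lt_min (div_pos (Real.log_pos (by norm_num)) hC3) (div_pos (div_pos hlogY (by positivity)) (by norm_num))

/-- The mesh threshold is positive once `x^{18} Z_m(x) ≥ 1600` and `a ≠ b`. [folklore] -/
theorem meshThreshold_pos {x : ℝ} {m : ℕ} (hm : 1600 ≤ x ^ 18 * Zbox m x) {a b : ℂ} (hab : a ≠ b) :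
    0 < meshThreshold m x a b := by
  have hab' : 0 < ‖a - b‖ := norm_pos_iff.2 (sub_ne_zero.2 hab)
  have hK : (0 : ℝ) < KP m 4 := Nat.cast_pos.2 (by unfold KP; omega)
  have hRd2 : (0 : ℝ) < (RdP m 4 : ℝ) + 2 := by have := Nat.cast_nonneg (α := ℝ) (RdP m 4); linarith
  have hlogY : 0 < Real.log (x ^ 18 * Zbox m x) := Real.log_pos (by linarith)
  have hL1 : (1 : ℝ) ≤ OddTile.side m 4 := by exact_mod_cast OddTile.side_pos (m := m) (r := 4)
  have hlogxp : 0 ≤ Real.log (max 1 x⁻¹) := Real.log_nonneg (le_max_left _ _)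
  unfold meshThreshold
  refine lt_min (lt_min (by norm_num) (one_div_pos.2 (pow_pos hK 2))) (lt_min (div_pos hab' (by norm_num))
    (lt_min (one_div_pos.2 (mul_pos (mul_pos (by norm_num) (by linarith)) hRd2)) ?_))
  exact div_pos hlogY (mul_pos (mul_pos (by norm_num) (pow_pos (by linarith) 2)) (by linarith))

/-- **The mesh threshold shrinks like the inverse square of the box scale**:
`δ₀(m, x, a, b) ≤ (9m + 75)⁻²`, so the box scale `m` is usable only at meshes `δ < (9m+75)⁻²`.
[cite: DuminilCopinKozmaYadin2014, Theorem 6] -/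
theorem meshThreshold_le (m : ℕ) (x : ℝ) (a b : ℂ) :
    meshThreshold m x a b ≤ 1 / (9 * (m : ℝ) + 75) ^ 2 := by
  have h : (KP m 4 : ℝ) = 9 * (m : ℝ) + 75 := by rw [KP_four]; push_cast; ring
  unfold meshThreshold
  rw [← h]
  exact (min_le_left _ _).trans (min_le_right _ _)

/-! ### The effective Theorem 6 for the disk -/

/-- **Theorem 6 of Duminil-Copin–Kozma–Yadin for the disk, effective form (proved).** For EVERY
fugacity `x > 0` and every box scale `m` with `x^{18} Z_m(x) ≥ 1600`, for boundary points
`a ≠ b` of `𝔻`, meshes `0 < δ < meshThreshold m x a b` and closest sites `a_δ, b_δ`: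
`P_{(𝔻_δ,a_δ,b_δ,x)}[some component of 𝔻_δ ∖ Γ_δ^ξ has more than s sites]
  ≤ (prefConst m x / δ²) e^{-rateConst m x · s}`, `ξ = xiP m 4 = 28m + 224`.
Supercriticality is not assumed: the print uses `x > 1/μ` only through "some `m = m(x,2)` such
that `Z_m(x) > 2λ`" (proof of Theorem 6, p. 7; "or equivalently `Z_m(x)` large enough", §3
p. 6). The proof is that of `DKY2014_thm6_disk_holds` with the scale `m` left free.
[cite: DuminilCopinKozmaYadin2014, Theorem 6 and §3 (proof of Theorem 6)] -/
theorem DKY2014_thm6_disk_effective {x : ℝ} (hx : 0 < x) {m : ℕ} (hm : 1600 ≤ x ^ 18 * Zbox m x)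
    {a b : ℂ} (ha : ‖a‖ = 1) (hb : ‖b‖ = 1) (hab : a ≠ b) {δ : ℝ} (hδ : 0 < δ)
    (hδlt : δ < meshThreshold m x a b) {u v : Site 2} (hu : IsClosestSite unitDisk δ a u)
    (hv : IsClosestSite unitDisk δ b v) {s : ℝ} (hs : 0 < s) :
    lawAt x unitDisk δ u v {γ | HasLargeHole (xiP m 4 : ℝ) s γ} ≤
      ENNReal.ofReal (prefConst m x / δ ^ 2 * Real.exp (-(rateConst m x * s))) := by
  have hx18 : 0 < x ^ 18 := by positivity
  have hZ : 0 < Zbox m x := by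
    by_contra hZ
    push Not at hZ
    have : x ^ 18 * Zbox m x ≤ 0 := mul_nonpos_of_nonneg_of_nonpos hx18.le hZ
    linarith
  set Y : ℝ := x ^ 18 * Zbox m x with hYdef
  have eY : x ^ (4 * 4 + 2) * Zbox m x = Y := by
    show x ^ (4 * 4 + 2) * Zbox m x = x ^ 18 * Zbox m x
    norm_num
  have hY : 1600 ≤ x ^ (4 * 4 + 2) * Zbox m x := by rw [eY]; exact hm
  set L : ℝ := (OddTile.side m 4 : ℝ) with hLdef
  have hL1 : 1 ≤ L := by rw [hLdef]; exact_mod_cast OddTile.side_pos (m := m) (r := 4)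
  have hlogY : 0 < Real.log Y := Real.log_pos (by rw [hYdef]; linarith)
  have hlogxp : 0 ≤ Real.log (max 1 x⁻¹) := Real.log_nonneg (le_max_left _ _)
  -- the constants
  set cM : ℝ := Real.log 64 / C3P m 4 with hcM
  set cB : ℝ := Real.log Y / (16 * L ^ 2) with hcB
  set A : ℝ := Amain m 4 x with hA
  set CB : ℝ := 16000 / Zbox m x with hCB
  have hC3 : (0 : ℝ) < C3P m 4 := Nat.cast_pos.2 (by unfold C3P; positivity)
  have hcB0 : 0 < cB := by rw [hcB]; exact div_pos hlogY (by positivity)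
  have hρ0 : (0 : ℝ) ≤ (rhoP m 4 : ℝ) + 1 := by have := Nat.cast_nonneg (α := ℝ) (rhoP m 4); linarith
  have hC70 : 0 ≤ C7 m 4 x := by
    unfold C7
    exact div_nonneg (mul_nonneg (mul_nonneg (by norm_num) hρ0) (pow_nonneg (zero_le_one.trans (le_max_left _ _)) _)) hZ.le
  have hA0 : 0 ≤ A := by
    rw [hA]; unfold Amain
    have hL0 : (0 : ℝ) ≤ (OddTile.side m 4 : ℝ) := Nat.cast_nonneg _
    exact mul_nonneg (by norm_num) (mul_nonneg (by norm_num) (mul_nonneg hL0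
      (mul_nonneg (mul_nonneg (by norm_num) hC70) (by norm_num))))
  -- the goal in terms of the local constants
  have hpref : prefConst m x = A + max CB 0 := rfl
  have hrate : rateConst m x = min cM (cB / 25) := rfl
  rw [hpref, hrate]
  -- unpack the smallness of `δ`
  have hδab' : 0 < ‖a - b‖ := norm_pos_iff.2 (sub_ne_zero.2 hab)
  have hδ10 : δ ≤ 1 / 10 := hδlt.le.trans ((min_le_left _ _).trans (min_le_left _ _))
  have hδK : δ ≤ 1 / (KP m 4 : ℝ) ^ 2 := hδlt.le.trans ((min_le_left _ _).trans (min_le_right _ _))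
  have hδab : δ ≤ ‖a - b‖ / 26 := hδlt.le.trans ((min_le_right _ _).trans (min_le_left _ _))
  have hδM : δ ≤ 1 / (8 * L * ((RdP m 4 : ℝ) + 2)) :=
    hδlt.le.trans ((min_le_right _ _).trans ((min_le_right _ _).trans (min_le_left _ _)))
  have hδA : δ ≤ Real.log (x ^ (4 * 4 + 2) * Zbox m x) / (16 * L ^ 2 * (43 * Real.log (max 1 x⁻¹) + 2)) := by
    rw [eY]
    exact hδlt.le.trans ((min_le_right _ _).trans ((min_le_right _ _).trans (min_le_right _ _)))
  have hδ1 : δ ≤ 1 := hδ10.trans (by norm_num)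
  have hδ4 : δ ≤ 1 / 4 := hδ10.trans (by norm_num)
  -- the endpoints are far apart
  have huv : 10 ≤ l1dist u v := by
    obtain ⟨i, hi⟩ := exists_le_abs_sub_of_isClosestSite hδ hδ4 ha hb hu hv (Λ := 10) (by push_cast; linarith)
    simp only [l1dist]
    have := abs_nonneg (u 0 - v 0); have := abs_nonneg (u 1 - v 1)
    fin_cases i <;> simp at hi <;> omega
  -- the deep square
  obtain ⟨hM1, -, hRd⟩ := Mpar_bounds (m := m) (r := 4) hδ hδM
  have hdeepM : ∀ τ : Site 2, (∀ k, |τ k| ≤ Mpar m 4 δ) → IsDeepTile δ m 4 (RdP m 4) τ := fun τ hτ =>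
    isDeepTile_of_le_Mpar hδ hRd hτ
  -- large `s`: the event is empty
  by_cases hsbig : ((2 * ⌈1 / δ⌉₊ + 1 : ℕ) : ℝ) ^ 2 ≤ s
  · have hempty : {γ : DomainSAW unitDisk δ u v | HasLargeHole (xiP m 4 : ℝ) s γ} = ∅ := by
      ext γ
      simp only [Set.mem_setOf_eq, Set.mem_empty_iff_false, iff_false]
      intro h
      have := lt_of_hasLargeHole hδ h
      push_cast at this hsbig
      linarith
    rw [hempty, measure_empty]; exact bot_le
  push Not at hsbig
  have hs25 : s < 25 / δ ^ 2 := hsbig.trans_le (ceil_sq_le hδ hδ1)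
  -- the Peierls sum
  have hsum := lawAt_hasLargeHole_le_sums (m := m) (r := 4) hδ hδ10 hδK le_rfl hx hZ ha hb hu hv huv hM1 hdeepM hs.le
  refine hsum.trans (ENNReal.ofReal_le_ofReal ?_)
  have h1 := mainSum_le_exp (m := m) (r := 4) hδ hδ1 hx hZ hY s
  have h2 := annSum_le_exp (m := m) (r := 4) hδ hδ1 hδM hx hZ hY hδA
  have h3 := final_constant_le (cG := cM) (CB := CB) (A := A) hδ hδ1 hs.le hs25 hcB0 hA0
  have e2 : Real.log (x ^ (4 * 4 + 2) * Zbox m x) / (16 * L ^ 2) * (1 / δ) ^ 2 = cB / δ ^ 2 := by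
    rw [eY, hcB]; field_simp
  rw [e2] at h2
  calc mainSum m 4 δ x s + annSum m 4 δ x
      ≤ A / δ ^ 2 * Real.exp (-(cM * s)) + CB * Real.exp (-(cB / δ ^ 2)) := add_le_add h1 h2
    _ ≤ max (CB * Real.exp (-(cB / δ ^ 2))) 0 + A / δ ^ 2 * Real.exp (-(cM * s)) := by
        rw [add_comm]; exact add_le_add (le_max_left _ _) le_rfl
    _ ≤ (A + max CB 0) / δ ^ 2 * Real.exp (-(min cM (cB / 25) * s)) := h3

/-- **The Steps fact from the effective theorem**: Proposition 3 (`limsup_m Z_m(x) = ∞` for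
`x > 1/μ`) is the ONLY supercritical input of Theorem 6 for the disk.
[cite: DuminilCopinKozmaYadin2014, Proposition 3 and Theorem 6] -/
theorem DKY2014_thm6_disk_of_effective (h3 : DKY2014_prop3) : DKY2014_thm6_disk := by
  intro x hxc
  have hx : 0 < x := criticalFugacity_nonneg.trans_lt hxc
  obtain ⟨m, hm⟩ := (h3 x hxc (1600 / x ^ 18)).exists
  have hx18 : 0 < x ^ 18 := by positivity
  have hm' : 1600 ≤ x ^ 18 * Zbox m x := by
    rw [div_le_iff₀ hx18] at hm; linarith
  refine ⟨(xiP m 4 : ℝ), Nat.cast_pos.2 (by unfold xiP; omega), rateConst m x, rateConst_pos hm',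
    prefConst m x, fun a b ha hb hab => ⟨meshThreshold m x a b, meshThreshold_pos hm' hab,
      fun δ hδ hδlt u v hu hv s hs => DKY2014_thm6_disk_effective hx hm' ha hb hab hδ hδlt hu hv hs⟩⟩

/-! ### Theorem 1, weak space-filling and no SLE_{8/3} at every fugacity meeting the criterion -/

/-- **Theorem 1 at `(x, m)`**: for `x > 0` and a box scale with `x^{18} Z_m(x) ≥ 1600`, boundary
points `a ≠ b` and closest sites `a_δ, b_δ`, the probability of a component of
`𝔻_δ ∖ Γ_δ^{28m+224}` with more than `(3/c) log(1/δ)` sites tends to `0` (indeed is `≤ C δ`),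
`c = rateConst m x`. ("Taking `λ = C₁ log(1/δ)` for `C₁` sufficiently large gives the result",
p. 6.) [cite: DuminilCopinKozmaYadin2014, Theorem 1 and §3 (Theorem 1 given Theorem 6)] -/
theorem tendsto_lawAt_hasLargeHole_of_Zbox {x : ℝ} (hx : 0 < x) {m : ℕ} (hm : 1600 ≤ x ^ 18 * Zbox m x)
    {a b : ℂ} (ha : ‖a‖ = 1) (hb : ‖b‖ = 1) (hab : a ≠ b) {A B : ℝ → Site 2}
    (hAB : ∀ δ : ℝ, 0 < δ → IsClosestSite unitDisk δ a (A δ) ∧ IsClosestSite unitDisk δ b (B δ)) :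
    Tendsto (fun δ : ℝ => lawAt x unitDisk δ (A δ) (B δ)
        {γ | HasLargeHole (xiP m 4 : ℝ) (3 / rateConst m x * Real.log (1 / δ)) γ}) (𝓝[>] 0) (𝓝 0) := by
  have hc := rateConst_pos hm
  have hδ₀ := meshThreshold_pos hm hab
  set c := rateConst m x with hcdef
  set C := prefConst m x with hCdef
  set δ₀ := meshThreshold m x a b with hδ₀def
  -- for `0 < δ < min δ₀ 1` the probability is at most `C δ`
  have hbound : ∀ δ : ℝ, 0 < δ → δ < min δ₀ 1 →
      lawAt x unitDisk δ (A δ) (B δ) {γ | HasLargeHole (xiP m 4 : ℝ) (3 / c * Real.log (1 / δ)) γ} ≤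
        ENNReal.ofReal (C * δ) := by
    intro δ hδ hδ1
    have hδ₀' : δ < δ₀ := lt_of_lt_of_le hδ1 (min_le_left _ _)
    have hδ1' : δ < 1 := lt_of_lt_of_le hδ1 (min_le_right _ _)
    have hs : 0 < 3 / c * Real.log (1 / δ) := by
      have : 0 < Real.log (1 / δ) := Real.log_pos (by rw [lt_div_iff₀ hδ]; linarith)
      positivity
    have := DKY2014_thm6_disk_effective hx hm ha hb hab hδ hδ₀' (hAB δ hδ).1 (hAB δ hδ).2 hs
    rwa [peierls_bound_at_log hc hδ] at this
  have hupper : Tendsto (fun δ : ℝ => ENNReal.ofReal (C * δ)) (𝓝[>] 0) (𝓝 0) := by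
    have : Tendsto (fun δ : ℝ => C * δ) (𝓝 0) (𝓝 (C * 0)) :=
      (continuous_const.mul continuous_id).tendsto 0
    rw [mul_zero] at this
    simpa using (ENNReal.tendsto_ofReal this).mono_left nhdsWithin_le_nhds
  refine tendsto_of_tendsto_of_tendsto_of_le_of_le' tendsto_const_nhds hupper
    (Eventually.of_forall fun δ => zero_le) ?_
  filter_upwards [Ioo_mem_nhdsGT (lt_min hδ₀ one_pos)] with δ hδ
  exact hbound δ hδ.1 hδ.2

/-- **Weak space-filling at `(x, m)`**: for `x > 0` and a box scale with `x^{18} Z_m(x) ≥ 1600`,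
the laws `P_{(𝔻_δ,a_δ,b_δ,x)}` miss no open subset of the disk in the limit
(`IsSpaceFillingFamily`), for all boundary points `a ≠ b` and closest-site families. The proof
is that of `isSpaceFillingFamily_of_DKY2014_thm1` at a single fugacity.
[cite: DuminilCopinKozmaYadin2014, §1 (When x > 1/μ) and Theorem 1] -/
theorem isSpaceFillingFamily_of_Zbox {x : ℝ} (hx : 0 < x) {m : ℕ} (hm : 1600 ≤ x ^ 18 * Zbox m x)
    {a b : ℂ} (ha : ‖a‖ = 1) (hb : ‖b‖ = 1) (hab : a ≠ b) {A B : ℝ → Site 2}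
    (hAB : ∀ δ : ℝ, 0 < δ → IsClosestSite unitDisk δ a (A δ) ∧ IsClosestSite unitDisk δ b (B δ)) :
    IsSpaceFillingFamily x unitDisk A B := by
  intro U hU hUΩ hUne
  obtain ⟨z, hz⟩ := hUne
  obtain ⟨r, hr, hzr⟩ := Metric.isOpen_iff.1 hU z hz
  set ξ : ℝ := (xiP m 4 : ℝ) with hξdef
  have hξ : 0 < ξ := Nat.cast_pos.2 (by unfold xiP; omega)
  set c : ℝ := 3 / rateConst m x with hcdef
  have hc : 0 < c := div_pos (by norm_num) (rateConst_pos hm)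
  have hT := tendsto_lawAt_hasLargeHole_of_Zbox hx hm ha hb hab hAB
  -- for small `δ`, avoiding `U` forces a hole of more than `c log(1/δ)` sites
  have hlog : ∀ᶠ δ in 𝓝[>] (0 : ℝ), -(r / (4 * c)) < Real.log δ * δ := by
    have hlim := tendsto_log_mul_rpow_nhdsGT_zero zero_lt_one
    have hev := hlim.eventually (Ioi_mem_nhds (show -(r / (4 * c)) < (0 : ℝ) by
      have : 0 < r / (4 * c) := by positivity
      linarith))
    filter_upwards [hev] with δ hδ
    simpa only [Real.rpow_one] using hδ
  have hsmall : ∀ᶠ δ in 𝓝[>] (0 : ℝ), δ ∈ Set.Ioo 0 (min (r / 8) (r / (2 * ξ))) :=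
    Ioo_mem_nhdsGT (lt_min (by positivity) (by positivity))
  have hev : ∀ᶠ δ in 𝓝[>] (0 : ℝ),
      lawAt x unitDisk δ (A δ) (B δ) {γ | ∀ v ∈ γ.walk.support, meshPoint δ v ∉ U} ≤
        lawAt x unitDisk δ (A δ) (B δ) {γ | HasLargeHole ξ (c * Real.log (1 / δ)) γ} := by
    filter_upwards [hlog, hsmall] with δ hlogδ hδ
    have hδ0 : 0 < δ := hδ.1
    have hδ8 : 8 * δ ≤ r := by
      have := (hδ.2.le.trans (min_le_left _ _))
      linarith
    have hδξ : δ * ξ ≤ r / 2 := by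
      have h2 : δ ≤ r / (2 * ξ) := hδ.2.le.trans (min_le_right _ _)
      rw [le_div_iff₀ (by positivity)] at h2
      linarith
    refine measure_mono fun γ hγ => ?_
    exact hasLargeHole_of_forall_notMem_ball hδ0 (hzr.trans hUΩ) hδ8 hδξ (hAB δ hδ0).1.1
      (log_threshold hc hδ0 hlogδ) γ (fun v hv hvz => hγ v hv (hzr hvz))
  exact tendsto_of_tendsto_of_tendsto_of_le_of_le' tendsto_const_nhds hT
    (Eventually.of_forall fun δ => zero_le) hev

/-- **No SLE_{8/3} at any fugacity meeting the box-polygon criterion** (unconditional): if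
`x > 0` and `x^{18} Z_m(x) ≥ 1600` for some `m`, then `¬ SAWScalingLimitAt x` — witnessed by
`(𝔻; 1, -1)` with closest-site endpoints, where the laws are space-filling
(`isSpaceFillingFamily_of_Zbox`) while chordal SLE_{8/3} misses a ball with positive probability
(`IsSLECurve.exists_ball_measure_disjoint_ne_zero` fed with the tree's theorems
`sle_restriction_eightThirds_holds` [LSW03, Thm 6.1] and
`ae_isSimpleTrace_sleTrace_of_le_four_holds` [RS05, Thm 6.1]). For `x > x_c` this is
`not_sawScalingLimitAt_of_DKY2014_thm1`; the point is that supercriticality has been replaced by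
one inequality between numbers. [cite: DuminilCopinKozmaYadin2014, Theorem 1 and Conjecture 11] -/
theorem not_sawScalingLimitAt_of_Zbox {x : ℝ} (hx : 0 < x) {m : ℕ} (hm : 1600 ≤ x ^ 18 * Zbox m x) :
    ¬ SAWScalingLimitAt x := by
  obtain ⟨A, hA⟩ := exists_closestSiteFamily (1 : ℂ)
  obtain ⟨B, hB⟩ := exists_closestSiteFamily (-1 : ℂ)
  have hAB : ∀ δ : ℝ, 0 < δ →
      IsClosestSite unitDisk δ 1 (A δ) ∧ IsClosestSite unitDisk δ (-1) (B δ) :=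
    fun δ hδ => ⟨hA δ hδ, hB δ hδ⟩
  have hne : (1 : ℂ) ≠ -1 := fun h => by
    have h' := congrArg Complex.re h
    norm_num at h'
  exact not_sawScalingLimitAt_of_isSpaceFillingFamily (D := DobrushinDomain.unitDisc)
    (isEndpointApprox_unitDisc_of_isClosestSite hAB)
    (isSpaceFillingFamily_of_Zbox hx hm (a := 1) (b := -1) norm_one (by simp) hne hAB)
    (fun _ hΓ => hΓ.exists_ball_measure_disjoint_ne_zero sle_restriction_eightThirds_holds
      ae_isSimpleTrace_sleTrace_of_le_four_holds)
    isProjectiveLimit_preWienerMeasure_holds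

/-! ### The enumerative necessary condition at `x_c` -/

/-- **The sub-problem bounds the critical box-polygon partition functions.** If the planar SAW
converges to SLE_{8/3} (`SAWScalingLimit`, the conjunct of the summit), then for EVERY box scale
`m`, `x_c^{18} Z_m(x_c) < 1600`: otherwise the critical walk in the disk would be space-filling
(`not_sawScalingLimitAt_of_Zbox` at `x = x_c`, `sawScalingLimitAt_criticalFugacity`). An exact
enumerative falsifier of the conjunct; rigorously only polynomial bounds `Z_m(x_c) = O(m⁴)` are
known (`q_N ≤ μ^N` [cite: MadrasSlade1993, (3.2.5)]), the expected behaviour being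
`sup_m Z_m(x_c) < ∞`. [cite: DuminilCopinKozmaYadin2014, §1 (When x = 1/μ) and Problem 10] -/
theorem Zbox_lt_of_sawScalingLimit (h : SAWScalingLimit) (m : ℕ) :
    criticalFugacity ^ 18 * Zbox m criticalFugacity < 1600 := by
  by_contra hge
  push Not at hge
  exact not_sawScalingLimitAt_of_Zbox criticalFugacity_pos_lt_one'.1 hge
    (sawScalingLimitAt_criticalFugacity.2 h)

/-- **A YES to Problem 10 (disk) bounds the critical box-polygon partition functions**: if the
critical SAW in the unit disk is not space-filling (`DKY2014_problem10_disk`, OPEN), then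
`x_c^{18} Z_m(x_c) < 1600` for every `m` (`isSpaceFillingFamily_of_Zbox` at `x = x_c`).
[cite: DuminilCopinKozmaYadin2014, Problem 10] -/
theorem Zbox_lt_of_DKY2014_problem10_disk (h : DKY2014_problem10_disk) (m : ℕ) :
    criticalFugacity ^ 18 * Zbox m criticalFugacity < 1600 := by
  by_contra hge
  push Not at hge
  obtain ⟨A, hA⟩ := exists_closestSiteFamily (1 : ℂ)
  obtain ⟨B, hB⟩ := exists_closestSiteFamily (-1 : ℂ)
  have hAB : ∀ δ : ℝ, 0 < δ →
      IsClosestSite unitDisk δ 1 (A δ) ∧ IsClosestSite unitDisk δ (-1) (B δ) :=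
    fun δ hδ => ⟨hA δ hδ, hB δ hδ⟩
  have hne : (1 : ℂ) ≠ -1 := fun h => by
    have h' := congrArg Complex.re h
    norm_num at h'
  exact h 1 (-1) norm_one (by simp) hne A B hAB
    (isSpaceFillingFamily_of_Zbox criticalFugacity_pos_lt_one'.1 hge norm_one (by simp) hne hAB)

/-! ### Reach along fugacity schedules `x(δ) → x_c⁺` -/

/-- **Space-filling along a fugacity schedule with certified box scales.** Let `X` be a fugacity
schedule and `M` box scales such that, for all small `δ > 0`, `X δ > 0`,
`(X δ)^{18} Z_{M δ}(X δ) ≥ 1600` and `δ < meshThreshold (M δ) (X δ) a b`, the tubes shrink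
(`ξ(M δ) · δ → 0`) and the Peierls bound at hole size `r/δ` tends to `0` for every `r > 0`
(`(prefConst/δ²) e^{-rateConst · r/δ} → 0`; automatic for bounded `M`, a growth condition on
`M δ` otherwise, cf. `meshThreshold_le`). Then the laws `P_{(𝔻_δ, a_δ, b_δ, X δ)}` are
space-filling (`IsSpaceFillingLaws`). This is the effective form of the diagonal-schedule
theorem `exists_schedule_isSpaceFillingLaws` of `SupercriticalSAWSpaceFillingNarrow`: the
inexplicit thresholds there are replaced by the box-polygon criterion at scale `M δ`.
[cite: DuminilCopinKozmaYadin2014, Theorem 1 and Theorem 6] -/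
theorem isSpaceFillingLaws_of_Zbox_schedule {X : ℝ → ℝ} {M : ℝ → ℕ} {a b : ℂ} (ha : ‖a‖ = 1)
    (hb : ‖b‖ = 1) (hab : a ≠ b) {A B : ℝ → Site 2}
    (hAB : ∀ δ : ℝ, 0 < δ → IsClosestSite unitDisk δ a (A δ) ∧ IsClosestSite unitDisk δ b (B δ))
    (hX : ∀ᶠ δ in 𝓝[>] (0 : ℝ),
      0 < X δ ∧ 1600 ≤ X δ ^ 18 * Zbox (M δ) (X δ) ∧ δ < meshThreshold (M δ) (X δ) a b)
    (hξ : Tendsto (fun δ : ℝ => (xiP (M δ) 4 : ℝ) * δ) (𝓝[>] 0) (𝓝 0))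
    (hrate : ∀ r : ℝ, 0 < r → Tendsto (fun δ : ℝ => prefConst (M δ) (X δ) / δ ^ 2 *
        Real.exp (-(rateConst (M δ) (X δ) * (r / δ)))) (𝓝[>] 0) (𝓝 0)) :
    IsSpaceFillingLaws unitDisk A B fun δ => lawAt (X δ) unitDisk δ (A δ) (B δ) := by
  intro U hU hUΩ hUne
  obtain ⟨z, hz⟩ := hUne
  obtain ⟨r, hr, hzr⟩ := Metric.isOpen_iff.1 hU z hz
  have hsmall : ∀ᶠ δ in 𝓝[>] (0 : ℝ), δ ∈ Set.Ioo 0 (r / 8) := Ioo_mem_nhdsGT (by positivity)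
  have hξev : ∀ᶠ δ in 𝓝[>] (0 : ℝ), (xiP (M δ) 4 : ℝ) * δ < r / 2 :=
    hξ.eventually (Iio_mem_nhds (by positivity : (0 : ℝ) < r / 2))
  have hev : ∀ᶠ δ in 𝓝[>] (0 : ℝ),
      lawAt (X δ) unitDisk δ (A δ) (B δ) {γ | ∀ v ∈ γ.walk.support, meshPoint δ v ∉ U} ≤
        ENNReal.ofReal (prefConst (M δ) (X δ) / δ ^ 2 *
          Real.exp (-(rateConst (M δ) (X δ) * (r / 8 / δ)))) := by
    filter_upwards [hX, hsmall, hξev] with δ hXδ hδ hξδ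
    obtain ⟨hx, hm, hδlt⟩ := hXδ
    have hδ0 : 0 < δ := hδ.1
    have hδ8 : 8 * δ ≤ r := by have := hδ.2.le; linarith
    have hδξ : δ * (xiP (M δ) 4 : ℝ) ≤ r / 2 := by rw [mul_comm]; exact hξδ.le
    have hs : r / 8 / δ < (⌊r / (4 * δ)⌋₊ : ℝ) + 1 := by
      have h1 : r / 8 / δ ≤ r / (4 * δ) := by
        rw [div_div, div_le_div_iff₀ (by positivity) (by positivity)]
        nlinarith
      exact h1.trans_lt (Nat.lt_floor_add_one _)
    have hspos : 0 < r / 8 / δ := by positivity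
    calc lawAt (X δ) unitDisk δ (A δ) (B δ) {γ | ∀ v ∈ γ.walk.support, meshPoint δ v ∉ U}
        ≤ lawAt (X δ) unitDisk δ (A δ) (B δ) {γ | HasLargeHole (xiP (M δ) 4 : ℝ) (r / 8 / δ) γ} :=
          measure_mono fun γ hγ => hasLargeHole_of_forall_notMem_ball hδ0 (hzr.trans hUΩ) hδ8 hδξ
            (hAB δ hδ0).1.1 hs γ (fun v hv hvz => hγ v hv (hzr hvz))
      _ ≤ _ := DKY2014_thm6_disk_effective hx hm ha hb hab hδ0 hδlt (hAB δ hδ0).1 (hAB δ hδ0).2 hspos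
  have hupper : Tendsto (fun δ : ℝ => ENNReal.ofReal (prefConst (M δ) (X δ) / δ ^ 2 *
      Real.exp (-(rateConst (M δ) (X δ) * (r / 8 / δ))))) (𝓝[>] 0) (𝓝 0) := by
    have := ENNReal.tendsto_ofReal (hrate (r / 8) (by positivity))
    rwa [ENNReal.ofReal_zero] at this
  exact tendsto_of_tendsto_of_tendsto_of_le_of_le' tendsto_const_nhds hupper
    (Eventually.of_forall fun δ => zero_le) hev

/-- **No SLE_{8/3} along a fugacity schedule with certified box scales** (unconditional): under
the hypotheses of `isSpaceFillingLaws_of_Zbox_schedule` for `(𝔻; 1, -1)`,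
`¬ SAWScalingLimitAlong X`. So a window-robust strengthening `WindowRobustSAWScalingLimit w` is
refuted as soon as ONE schedule inside the window carries certified scales — the explicit
substitute for the inexplicit blocked window `w₀` of `exists_window_tendsto_zero_not_windowRobust`.
[cite: DuminilCopinKozmaYadin2014, Theorem 1 and Conjecture 11] -/
theorem not_sawScalingLimitAlong_of_Zbox_schedule {X : ℝ → ℝ} {M : ℝ → ℕ}
    (hX : ∀ᶠ δ in 𝓝[>] (0 : ℝ),
      0 < X δ ∧ 1600 ≤ X δ ^ 18 * Zbox (M δ) (X δ) ∧ δ < meshThreshold (M δ) (X δ) 1 (-1))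
    (hξ : Tendsto (fun δ : ℝ => (xiP (M δ) 4 : ℝ) * δ) (𝓝[>] 0) (𝓝 0))
    (hrate : ∀ r : ℝ, 0 < r → Tendsto (fun δ : ℝ => prefConst (M δ) (X δ) / δ ^ 2 *
        Real.exp (-(rateConst (M δ) (X δ) * (r / δ)))) (𝓝[>] 0) (𝓝 0)) :
    ¬ SAWScalingLimitAlong X := by
  obtain ⟨A, hA⟩ := exists_closestSiteFamily (1 : ℂ)
  obtain ⟨B, hB⟩ := exists_closestSiteFamily (-1 : ℂ)
  have hAB : ∀ δ : ℝ, 0 < δ →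
      IsClosestSite unitDisk δ 1 (A δ) ∧ IsClosestSite unitDisk δ (-1) (B δ) :=
    fun δ hδ => ⟨hA δ hδ, hB δ hδ⟩
  have hne : (1 : ℂ) ≠ -1 := fun h => by
    have h' := congrArg Complex.re h
    norm_num at h'
  exact not_sawScalingLimitAlong_of_isSpaceFillingLaws (D := DobrushinDomain.unitDisc)
    (isEndpointApprox_unitDisc_of_isClosestSite hAB)
    (isSpaceFillingLaws_of_Zbox_schedule (a := 1) (b := -1) norm_one (by simp) hne hAB hX hξ hrate)
    (fun _ hΓ => hΓ.exists_ball_measure_disjoint_ne_zero sle_restriction_eightThirds_holds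
      ae_isSimpleTrace_sleTrace_of_le_four_holds)
    isProjectiveLimit_preWienerMeasure_holds

/-- A window is refuted by one certified schedule inside it. [cite: DuminilCopinKozmaYadin2014, Theorem 1] -/
theorem not_windowRobustSAWScalingLimit_of_Zbox_schedule {w X : ℝ → ℝ} {M : ℝ → ℕ}
    (hw : ∀ᶠ δ in 𝓝[>] (0 : ℝ), |X δ - criticalFugacity| ≤ w δ)
    (hX : ∀ᶠ δ in 𝓝[>] (0 : ℝ),
      0 < X δ ∧ 1600 ≤ X δ ^ 18 * Zbox (M δ) (X δ) ∧ δ < meshThreshold (M δ) (X δ) 1 (-1))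
    (hξ : Tendsto (fun δ : ℝ => (xiP (M δ) 4 : ℝ) * δ) (𝓝[>] 0) (𝓝 0))
    (hrate : ∀ r : ℝ, 0 < r → Tendsto (fun δ : ℝ => prefConst (M δ) (X δ) / δ ^ 2 *
        Real.exp (-(rateConst (M δ) (X δ) * (r / δ)))) (𝓝[>] 0) (𝓝 0)) :
    ¬ WindowRobustSAWScalingLimit w :=
  fun h => not_sawScalingLimitAlong_of_Zbox_schedule hX hξ hrate (h X hw)

end SupercriticalSAW

open SupercriticalSAW

/-- **Barrier `SupercriticalSAWSpaceFillingStepsNarrow`** (the audited, effective form of the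
Steps fact `SupercriticalSAW.DKY2014_thm6_disk` / of `SupercriticalSAWSpaceFilling`; PROVED
below, `SupercriticalSAWSpaceFillingStepsNarrow_holds`): Theorem 1 of Duminil-Copin–Kozma–Yadin
with the hypothesis "`x > 1/μ`" replaced by what its proof uses — ONE box scale `m` with
`x^{18} Z_m(x) ≥ 1600` (`Z_m(x)` the partition function of polygons of `[0,2m+1]²` through the
four cardinal edges, `Literature.Probability.RandomPlanarGeometry.SAW.Zbox`) — valid at EVERY
fugacity `x > 0`, with the tube radius explicit in the scale, `ξ = 28m + 224`.

BARRIER (structured block, D-0021):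
- technique_class: box-polygon-criterion fugacities (an SLE_{8/3} CONCLUSION `SupercriticalSAW.SAWScalingLimitAt x`, or `SAWScalingLimitAlong X` along a schedule, asserted at a fugacity `x` — resp. along `X δ` — admitting a box scale `m` with `x^{18} Z_m(x) ≥ 1600` at an admissible mesh `δ < meshThreshold m x a b ≤ (9m+75)⁻²`); this is the up-set `B = {x : ∃ m, x^{18} Z_m(x) ≥ 1600} ⊇ (x_c, ∞)` [cite: DuminilCopinKozmaYadin2014, Proposition 3], NOT an open neighbourhood condition and not intrinsically supercritical: "choosing `m` large enough (or equivalently `Z_m(x)` large enough)" [cite: DuminilCopinKozmaYadin2014, §3 (first paragraph)]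
- blocks: `SAWScalingLimitAt x` for every `x ∈ B` (`SupercriticalSAW.not_sawScalingLimitAt_of_Zbox`, unconditional), `SAWScalingLimitAlong X` and `WindowRobustSAWScalingLimit w` for schedules/windows carrying certified scales (`SupercriticalSAW.not_sawScalingLimitAlong_of_Zbox_schedule`, `SupercriticalSAW.not_windowRobustSAWScalingLimit_of_Zbox_schedule`); and, read contrapositively AT `x_c`, it turns the sub-problem into an enumerative constraint: `SAWScalingLimit → ∀ m, x_c^{18} Z_m(x_c) < 1600` (`SupercriticalSAW.Zbox_lt_of_sawScalingLimit`; likewise from a YES to Problem 10, `SupercriticalSAW.Zbox_lt_of_DKY2014_problem10_disk`) [cite: DuminilCopinKozmaYadin2014, Theorem 1 and Problem 10]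
- because: the printed proof of Theorem 6 uses `x > 1/μ` only through "some `m = m(x,2)` such that `Z_m(x) > 2λ`" [cite: DuminilCopinKozmaYadin2014, §3 (proof of Theorem 6)]; Proposition 7 (`P[bdist(γ_δ, V_F) = 1] ≤ C(x,m) Z_m(x)^{-|F|}`, `C(x,m) = 4^{100m} max(x⁶, x^{-100m+4})`) and the Peierls sum over connected box families hold for every `x > 0` and `m` [cite: DuminilCopinKozmaYadin2014, Proposition 7]; the tree's proof (`SupercriticalSAW.DKY2014_thm6_disk_effective`) has the same structure with margin `r = 4`, tube `28m + 224`, rate `min(log 64/(20m+161)², log(x^{18}Z_m(x))/(400(2m+11)²))` and mesh threshold `≤ (9m+75)⁻²`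
- evasions_known: none at fixed `x > x_c`; the reach into near-critical schedules is EXACTLY the growth of `m*(x) = min{m : x^{18} Z_m(x) ≥ 1600}` as `x ↓ x_c` against `δ^{-1/2}` (mesh threshold) — an enumerative quantity the source declares out of reach of its method: the maximising span of squared walks "seems difficult, probably no easier than the SLE_{8/3} conjecture. But we do not need to know its value" [cite: DuminilCopinKozmaYadin2014, §2 (proof of Proposition 3)]; with the only printed bounds (`m ≤ n/2`, `Z_m(x) ≥ (x^{n+1}μⁿe^{-c√n}/n)⁴` [cite: DuminilCopinKozmaYadin2014, Lemma 5 and Proposition 3]) the certified windows are polynomially wide (`x(δ) - x_c ≫ δ^{a}`, `a` small), far above the conjectural crossover `δ^{4/3}` of `SupercriticalSAWSpaceFillingNarrow`; conversely the criterion is a FINITE computation at any given `(x, m)`, so the barrier can be certified numerically at a specific near-critical fugacity without Proposition 3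
- scope_caveats: unit disk, `ℤ²`, closest-site endpoints, hole-size sense (as the Steps fact); the constant `1600` and the exponent `18` are artefacts of the tree's tile proof (`r = 4`), the print's threshold being `Z_m(x) > 2λ` with `λ` the lattice-animal constant [cite: DuminilCopinKozmaYadin2014, §3 (proof of Theorem 6)]; the bound `x_c^{18} Z_m(x_c) < 1600` implied by the conjunct is numerically remote (expected: `sup_m Z_m(x_c) < ∞`; rigorously only `Z_m(x_c) = O(m⁴)` from `q_N ≤ μ^N` [cite: MadrasSlade1993, (3.2.5)]), its value is logical: unbounded critical box-polygon partition functions would refute the summit conjunct through this file; the hexagonal-lattice version (where Conjecture 11 is posed) is asserted "in a straightforward way" in print [cite: DuminilCopinKozmaYadin2014, §1 (end)] but is not in the tree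
- status: established (proved in the tree: `SupercriticalSAWSpaceFillingStepsNarrow_holds`)

[cite: DuminilCopinKozmaYadin2014, Theorem 1 and Theorem 6] -/
def SupercriticalSAWSpaceFillingStepsNarrow : Prop :=
  ∀ x : ℝ, 0 < x → ∀ m : ℕ, 1600 ≤ x ^ 18 * Zbox m x →
    ∀ a b : ℂ, ‖a‖ = 1 → ‖b‖ = 1 → a ≠ b →
      ∃ c : ℝ, 0 < c ∧ ∀ A B : ℝ → Site 2,
        (∀ δ : ℝ, 0 < δ → IsClosestSite unitDisk δ a (A δ) ∧ IsClosestSite unitDisk δ b (B δ)) →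
        Tendsto (fun δ : ℝ =>
            lawAt x unitDisk δ (A δ) (B δ) {γ | HasLargeHole (28 * m + 224) (c * Real.log (1 / δ)) γ})
          (𝓝[>] 0) (𝓝 0)

/-- **The narrowed barrier holds** (from `SupercriticalSAW.tendsto_lawAt_hasLargeHole_of_Zbox`,
with `c = 3 / rateConst m x` and `ξ = xiP m 4 = 28m + 224`). [cite: DuminilCopinKozmaYadin2014, Theorem 1 and Theorem 6] -/
theorem SupercriticalSAWSpaceFillingStepsNarrow_holds : SupercriticalSAWSpaceFillingStepsNarrow := by
  intro x hx m hm a b ha hb hab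
  refine ⟨3 / rateConst m x, div_pos (by norm_num) (rateConst_pos hm), fun A B hAB => ?_⟩
  have h := tendsto_lawAt_hasLargeHole_of_Zbox hx hm ha hb hab hAB
  have e : ((xiP m 4 : ℕ) : ℝ) = 28 * (m : ℝ) + 224 := by rw [xiP_four]; push_cast; ring
  simpa only [e] using h

/-- **The narrowed barrier implies the catalogued one**: on `(x_c, ∞)` Proposition 3
(`DKY2014_prop3_holds`) supplies a certified scale `m`, and Theorem 1 follows with
`ξ = 28m + 224` — so `SupercriticalSAWSpaceFillingStepsNarrow` is a genuine sharpening of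
`SupercriticalSAWSpaceFilling`, supercriticality being used exactly once.
[cite: DuminilCopinKozmaYadin2014, Proposition 3 and Theorem 1] -/
theorem SupercriticalSAWSpaceFillingStepsNarrow.supercriticalSAWSpaceFilling
    (h : SupercriticalSAWSpaceFillingStepsNarrow) : SupercriticalSAWSpaceFilling := by
  refine supercriticalSAWSpaceFilling_iff.2 fun a b ha hb hab x hxc => ?_
  have hx : 0 < x := criticalFugacity_nonneg.trans_lt hxc
  obtain ⟨m, hm⟩ := (DKY2014_prop3_holds x hxc (1600 / x ^ 18)).exists
  have hm' : 1600 ≤ x ^ 18 * Zbox m x := by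
    rw [div_le_iff₀ (by positivity)] at hm; linarith
  obtain ⟨c, hc, hT⟩ := h x hx m hm' a b ha hb hab
  exact ⟨28 * m + 224, by positivity, c, hc, hT⟩

end Literature.Barriers.CriticalPhenomena
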